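import Mathlib
import HarnessLib
import HarnessLib.Audit
import Summits.ValiantsHypothesis.ValiantsHypothesis.Theorems.LacunarySymmetroidMatrixDescartesMultiplierQuotient
import Summits.ValiantsHypothesis.ValiantsHypothesis.Theorems.LacunarySymmetroidMatrixDescartesTopBinomial
import Summits.ValiantsHypothesis.ValiantsHypothesis.Theorems.LacunarySymmetroidMatrixDescartesZeroOnceLocal

/-!
# ValiantsHypothesis / LacunarySymmetroid — crux `MatrixDescartes` (stmt-ValiantsHypothesis-18050, V1), LINE (A) «product_plus_one»:
# IDENTICAL ROWS — one W row times `P^k` has at most FOUR positive critical points, every `k`, every ratio (towards crit-1 #411 THEOREM C = 3)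

Pen val-idea-25 g9 Sketch-T3-s59 types `IdenticalRowsAtMostThree` (crit-1 #411 THEOREM C, «exact on paper»): one W row `−α + κX^a + γX^c`
(`α, γ > 0 ≤ κ`) times the `k`-th power of ONE zero-change trinomial row `p + qX^a + sX^c` (`p, s > 0 ≤ q`) has at most three positive critical
points.  This file proves the bound FOUR for every `k` and every support ratio (`identicalRowsAtMostFour`) by the rate-function method of
✓ `…MultiplierQuotient` / `…SmallRatio`:
* with identical rows the rate function is `J = W/e − k·e − A` (`e`, `W` = the row's rate and variance, `A = θ²g/θg`), and AT A ZERO OF `J`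
  `t·ψ_B·θJ = k(k+1)·e²·T`, `T := (a + c − 3A) − (2k+1)·e` (`hJid`; the K-identity of ✓ `…SmallRatio` specialised: `w = e(ke + A)` there);
* `T` is STRICTLY DECREASING (`e` strictly increasing, `A` non-decreasing ✓ `ratio_mono`), so zeros of `J` with `T > 0` are strict up-crossings and
  those with `T < 0` strict down-crossings; by the localized zero-once lemmas (✓ `…ZeroOnceLocal`) `J` has at most one zero in `{T > 0}` and at
  most one in `{T < 0}` — hence (engine ✓ `exists_rateJ_zero_between_crit`) five critical points are impossible.
What is missing for THREE: the tangential zero `T = 0` (there `J ≥ 0` nearby; the multiplier quotient `F̂` is then strictly decreasing across it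
by the mean value theorem, so it cannot vanish on both sides) — recorded for the successor in the crux evidence NOTE of this seat.
HONEST FRAMING: free-standing helper cell (one T5-type row + `k` copies of a T1 row, bottom coupling); NOT Theorem C's sharp value; closes no stub;
`OneChangeFloorK3`, `MatrixDescartes` OPEN; `VP ≠ VNP` is NOT proved.  No definitions, no named facts, no sorry.
-/

set_option linter.dupNamespace false

namespace Summit.ValiantsHypothesis.ValiantsHypothesis.Theorems.LacunarySymmetroidMatrixDescartes

namespace ZeroChange

open Polynomial Finset Set Filter Topology

/-- **One W row times the `k`-th power of ONE zero-change trinomial row has at most FOUR positive critical points, for every `k` and every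
support ratio** (one above the pen's / crit-1 #411 THEOREM C value `3`; the sharp `3` needs in addition the tangential case of the sign
analysis below, see the file header). -/
theorem identicalRowsAtMostFour : ∀ (k a c : ℕ), 0 < a → a < c → ∀ (α κ γ p q s : ℝ),
    0 < α → 0 ≤ κ → 0 < γ → 0 < p → 0 ≤ q → 0 < s →
    posCrit (row a c (-α) κ γ * (row a c p q s) ^ k) ≤ 4 := by
  intro k a c ha hac α κ γ p₀ q₀ s₀ hα hκ hγ hp₀ hq₀ hs₀
  classical
  have hc : 0 < c := ha.trans hac
  have ha' : (0 : ℝ) < a := by exact_mod_cast ha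
  have hc' : (0 : ℝ) < c := by exact_mod_cast hc
  have hac' : (a : ℝ) < c := by exact_mod_cast hac
  -- constant coefficient rows
  obtain ⟨p, hp⟩ : ∃ p : Fin k → ℝ, ∀ i, p i = p₀ := ⟨fun _ => p₀, fun _ => rfl⟩
  obtain ⟨q, hq⟩ : ∃ q : Fin k → ℝ, ∀ i, q i = q₀ := ⟨fun _ => q₀, fun _ => rfl⟩
  obtain ⟨s, hs⟩ : ∃ s : Fin k → ℝ, ∀ i, s i = s₀ := ⟨fun _ => s₀, fun _ => rfl⟩
  have hpow : row a c p₀ q₀ s₀ ^ k = ∏ i : Fin k, row a c (p i) (q i) (s i) := by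
    rw [Finset.prod_congr rfl (fun i _ => by rw [hp, hq, hs]), Finset.prod_const, Finset.card_univ, Fintype.card_fin]
  rw [hpow]
  have h : ∀ i, 0 < p i ∧ 0 ≤ q i ∧ 0 ≤ s i := fun i => by rw [hp, hq, hs]; exact ⟨hp₀, hq₀, hs₀.le⟩
  have h' : ∀ i, 0 ≤ p i ∧ 0 ≤ q i ∧ 0 ≤ s i ∧ 0 < p i + q i + s i :=
    fun i => ⟨(h i).1.le, (h i).2.1, (h i).2.2, by linarith [(h i).1, (h i).2.1, (h i).2.2]⟩
  -- the case `k = 0`: the W row alone has no positive critical point (engine, `J = −G₂/G ≠ 0`)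
  rcases Nat.eq_zero_or_pos k with hk0 | hk
  · subst hk0
    refine le_trans (posCrit_le_one_of_rateJ_ne_zero 0 a c ha hac α κ γ p q s hκ hγ h' (fun ξ hξ => ?_)) (by norm_num)
    simp only [Finset.univ_eq_empty, Finset.sum_empty, zero_div, zero_sub, sub_zero, ne_eq]
    have hG : 0 < (a : ℝ) * κ * ξ ^ a + (c : ℝ) * γ * ξ ^ c := add_pos_of_nonneg_of_pos (by positivity) (by positivity)
    have hG₂ : 0 < (a : ℝ) ^ 2 * κ * ξ ^ a + (c : ℝ) ^ 2 * γ * ξ ^ c := add_pos_of_nonneg_of_pos (by positivity) (by positivity)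
    intro h0
    rw [neg_eq_zero, div_eq_zero_iff] at h0
    rcases h0 with h0 | h0
    · exact hG₂.ne' h0
    · exact hG.ne' h0
  have j₀ : Fin k := ⟨0, hk⟩
  -- the real functions
  obtain ⟨P, hP⟩ : ∃ P : Fin k → ℝ → ℝ, ∀ i t, P i t = p i + q i * t ^ a + s i * t ^ c := ⟨_, fun _ _ => rfl⟩
  obtain ⟨N, hN⟩ : ∃ N : Fin k → ℝ → ℝ, ∀ i t, N i t = (a : ℝ) * q i * t ^ a + (c : ℝ) * s i * t ^ c :=
    ⟨_, fun _ _ => rfl⟩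
  obtain ⟨M, hM⟩ : ∃ M : Fin k → ℝ → ℝ, ∀ i t, M i t = (a : ℝ) ^ 2 * q i * t ^ a + (c : ℝ) ^ 2 * s i * t ^ c :=
    ⟨_, fun _ _ => rfl⟩
  obtain ⟨L, hL⟩ : ∃ L : Fin k → ℝ → ℝ, ∀ i t, L i t = (a : ℝ) ^ 3 * q i * t ^ a + (c : ℝ) ^ 3 * s i * t ^ c :=
    ⟨_, fun _ _ => rfl⟩
  obtain ⟨ψ, hψ⟩ : ∃ ψ : Fin k → ℝ → ℝ, ∀ i t, ψ i t = N i t / P i t := ⟨_, fun _ _ => rfl⟩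
  obtain ⟨ψB, hψB⟩ : ∃ ψB : ℝ → ℝ, ∀ t, ψB t = ∑ i, ψ i t := ⟨_, fun _ => rfl⟩
  obtain ⟨V, hV⟩ : ∃ V : ℝ → ℝ, ∀ t, V t = ∑ i, (M i t / P i t - ψ i t ^ 2) := ⟨_, fun _ => rfl⟩
  obtain ⟨V₃, hV₃⟩ : ∃ V₃ : ℝ → ℝ, ∀ t, V₃ t = ∑ i, (L i t / P i t - M i t * N i t / P i t ^ 2
      - 2 * (N i t / P i t) * (M i t / P i t - (N i t / P i t) ^ 2)) := ⟨_, fun _ => rfl⟩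
  obtain ⟨G, hG⟩ : ∃ G : ℝ → ℝ, ∀ t, G t = (a : ℝ) * κ * t ^ a + (c : ℝ) * γ * t ^ c := ⟨_, fun _ => rfl⟩
  obtain ⟨G₂, hG₂⟩ : ∃ G₂ : ℝ → ℝ, ∀ t, G₂ t = (a : ℝ) ^ 2 * κ * t ^ a + (c : ℝ) ^ 2 * γ * t ^ c :=
    ⟨_, fun _ => rfl⟩
  obtain ⟨G₃, hG₃⟩ : ∃ G₃ : ℝ → ℝ, ∀ t, G₃ t = (a : ℝ) ^ 3 * κ * t ^ a + (c : ℝ) ^ 3 * γ * t ^ c :=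
    ⟨_, fun _ => rfl⟩
  obtain ⟨J, hJ⟩ : ∃ J : ℝ → ℝ, ∀ t, J t = V t / ψB t - ψB t - G₂ t / G t := ⟨_, fun _ => rfl⟩
  obtain ⟨J', hJ'⟩ : ∃ J' : ℝ → ℝ, ∀ t, J' t = ((V₃ t * ψB t - V t * V t) / ψB t ^ 2 - V t
      - (G₃ t * G t - G₂ t * G₂ t) / G t ^ 2) / t := ⟨_, fun _ => rfl⟩
  have hJfun : ∀ t, J t =
      (∑ i, (((a : ℝ) ^ 2 * q i * t ^ a + (c : ℝ) ^ 2 * s i * t ^ c) / (p i + q i * t ^ a + s i * t ^ c)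
          - (((a : ℝ) * q i * t ^ a + (c : ℝ) * s i * t ^ c) / (p i + q i * t ^ a + s i * t ^ c)) ^ 2)) /
        (∑ i, ((a : ℝ) * q i * t ^ a + (c : ℝ) * s i * t ^ c) / (p i + q i * t ^ a + s i * t ^ c))
      - (∑ i, ((a : ℝ) * q i * t ^ a + (c : ℝ) * s i * t ^ c) / (p i + q i * t ^ a + s i * t ^ c))
      - ((a : ℝ) ^ 2 * κ * t ^ a + (c : ℝ) ^ 2 * γ * t ^ c) / ((a : ℝ) * κ * t ^ a + (c : ℝ) * γ * t ^ c) := by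
    intro t
    rw [hJ, hV, hψB, hG₂, hG]
    simp only [hψ, hM, hN, hP]
  -- elementary facts
  have hPpos : ∀ i t, 0 < t → 0 < P i t := fun i t ht => by
    rw [hP]
    have := (h i).1
    have : 0 ≤ q i * t ^ a := mul_nonneg (h i).2.1 (pow_pos ht a).le
    have : 0 ≤ s i * t ^ c := mul_nonneg (h i).2.2 (pow_pos ht c).le
    linarith
  have hGpos : ∀ t, 0 < t → 0 < G t := fun t ht => by
    rw [hG]; exact add_pos_of_nonneg_of_pos (by positivity) (by positivity)
  have hNnn : ∀ i t, 0 < t → 0 ≤ N i t := fun i t ht => by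
    rw [hN]
    exact add_nonneg (mul_nonneg (mul_nonneg ha'.le (h i).2.1) (pow_pos ht a).le)
      (mul_nonneg (mul_nonneg hc'.le (h i).2.2) (pow_pos ht c).le)
  have hψnn : ∀ i t, 0 < t → 0 ≤ ψ i t := fun i t ht => by
    rw [hψ]; exact div_nonneg (hNnn i t ht) (hPpos i t ht).le
  have hψBnn : ∀ t, 0 < t → 0 ≤ ψB t := fun t ht => by
    rw [hψB]; exact sum_nonneg fun i _ => hψnn i t ht
  have hAgt : ∀ t, 0 < t → (a : ℝ) < G₂ t / G t := fun t ht => by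
    rw [lt_div_iff₀ (hGpos t ht), hG₂, hG]
    have : 0 < (c : ℝ) * γ * t ^ c * ((c : ℝ) - a) := by
      have := sub_pos.2 hac'
      positivity
    nlinarith [mul_nonneg (mul_nonneg ha'.le hκ) (pow_pos ht a).le]
  -- `ψ_B > 0` everywhere (the rows have a top letter `s₀ > 0`)
  have hψBpos : ∀ t, 0 < t → 0 < ψB t := by
    intro t ht
    have hNi : 0 < N j₀ t := by
      rw [hN, hs]
      exact add_pos_of_nonneg_of_pos (mul_nonneg (mul_nonneg ha'.le (h j₀).2.1) (pow_pos ht a).le) (by positivity)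
    have hψi : 0 < ψ j₀ t := by rw [hψ]; exact div_pos hNi (hPpos j₀ t ht)
    rw [hψB]
    exact lt_of_lt_of_le hψi (single_le_sum (f := fun j => ψ j t) (fun j _ => hψnn j t ht) (mem_univ j₀))
  -- the derivative of `J` on `(0,∞)`
  have hJd : ∀ t, 0 < t → HasDerivAt J (J' t) t := by
    intro t ht
    have ht0 : t ≠ 0 := ht.ne'
    have hpowa : (a : ℝ) * t ^ (a - 1) = (a : ℝ) * t ^ a / t := by
      rw [eq_div_iff ht0, mul_assoc, ← pow_succ, Nat.sub_add_cancel (show 1 ≤ a from ha)]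
    have hpowc : (c : ℝ) * t ^ (c - 1) = (c : ℝ) * t ^ c / t := by
      rw [eq_div_iff ht0, mul_assoc, ← pow_succ, Nat.sub_add_cancel (show 1 ≤ c from hc)]
    have hrow : ∀ u v w : ℝ, HasDerivAt (fun x => u + v * x ^ a + w * x ^ c)
        (((a : ℝ) * v * t ^ a + (c : ℝ) * w * t ^ c) / t) t := by
      intro u v w
      refine ((((hasDerivAt_pow a t).const_mul v).const_add u).fun_add
        ((hasDerivAt_pow c t).const_mul w)).congr_deriv ?_
      have e1 : v * ((a : ℝ) * t ^ (a - 1)) = (a : ℝ) * v * t ^ a / t := by rw [hpowa]; ring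
      have e2 : w * ((c : ℝ) * t ^ (c - 1)) = (c : ℝ) * w * t ^ c / t := by rw [hpowc]; ring
      rw [e1, e2]; ring
    have hrow0 : ∀ v w : ℝ, HasDerivAt (fun x => v * x ^ a + w * x ^ c)
        (((a : ℝ) * v * t ^ a + (c : ℝ) * w * t ^ c) / t) t := by
      intro v w
      refine (((hasDerivAt_pow a t).const_mul v).fun_add ((hasDerivAt_pow c t).const_mul w)).congr_deriv ?_
      have e1 : v * ((a : ℝ) * t ^ (a - 1)) = (a : ℝ) * v * t ^ a / t := by rw [hpowa]; ring
      have e2 : w * ((c : ℝ) * t ^ (c - 1)) = (c : ℝ) * w * t ^ c / t := by rw [hpowc]; ring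
      rw [e1, e2]; ring
    have hPd : ∀ i, HasDerivAt (P i) (N i t / t) t := by
      intro i
      refine ((hrow (p i) (q i) (s i)).congr_of_eventuallyEq (Filter.Eventually.of_forall (hP i))).congr_deriv ?_
      rw [hN]
    have hNd : ∀ i, HasDerivAt (N i) (M i t / t) t := by
      intro i
      refine ((hrow0 ((a : ℝ) * q i) ((c : ℝ) * s i)).congr_of_eventuallyEq
        (Filter.Eventually.of_forall (hN i))).congr_deriv ?_
      rw [hM]; ring
    have hMd : ∀ i, HasDerivAt (M i) (L i t / t) t := by
      intro i
      refine ((hrow0 ((a : ℝ) ^ 2 * q i) ((c : ℝ) ^ 2 * s i)).congr_of_eventuallyEq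
        (Filter.Eventually.of_forall (hM i))).congr_deriv ?_
      rw [hL]; ring
    have hψd : ∀ i, HasDerivAt (ψ i) ((M i t / P i t - ψ i t ^ 2) / t) t := by
      intro i
      have h1 := (hNd i).fun_div (hPd i) (hPpos i t ht).ne'
      refine (h1.congr_of_eventuallyEq (Filter.Eventually.of_forall (hψ i))).congr_deriv ?_
      have hP0 : P i t ≠ 0 := (hPpos i t ht).ne'
      rw [hψ]
      field_simp
    have hWd : ∀ i, HasDerivAt (fun x => M i x / P i x - ψ i x ^ 2)
        ((L i t / P i t - M i t * N i t / P i t ^ 2 - 2 * (N i t / P i t) * (M i t / P i t - (N i t / P i t) ^ 2)) / t) t := by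
      intro i
      have h1 := ((hMd i).fun_div (hPd i) (hPpos i t ht).ne').fun_sub ((hψd i).fun_mul (hψd i))
      have e : (fun x => M i x / P i x - ψ i x ^ 2) = fun x => M i x / P i x - ψ i x * ψ i x :=
        funext fun x => by ring
      rw [e]
      refine h1.congr_deriv ?_
      have hP0 : P i t ≠ 0 := (hPpos i t ht).ne'
      rw [hψ]
      field_simp
      ring
    have hVd : HasDerivAt V (V₃ t / t) t := by
      have h1 := HasDerivAt.fun_sum (u := univ) (fun i _ => hWd i)
      refine (h1.congr_of_eventuallyEq (Filter.Eventually.of_forall hV)).congr_deriv ?_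
      rw [hV₃, sum_div]
    have hψBd : HasDerivAt ψB (V t / t) t := by
      have h1 : HasDerivAt (fun x => ∑ i, ψ i x) (∑ i, (M i t / P i t - ψ i t ^ 2) / t) t :=
        HasDerivAt.fun_sum (u := univ) (fun i _ => hψd i)
      refine (h1.congr_of_eventuallyEq (Filter.Eventually.of_forall hψB)).congr_deriv ?_
      rw [hV, sum_div]
    have hGd : HasDerivAt G (G₂ t / t) t := by
      refine ((hrow0 ((a : ℝ) * κ) ((c : ℝ) * γ)).congr_of_eventuallyEq
        (Filter.Eventually.of_forall hG)).congr_deriv ?_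
      rw [hG₂]; ring
    have hG₂d : HasDerivAt G₂ (G₃ t / t) t := by
      refine ((hrow0 ((a : ℝ) ^ 2 * κ) ((c : ℝ) ^ 2 * γ)).congr_of_eventuallyEq
        (Filter.Eventually.of_forall hG₂)).congr_deriv ?_
      rw [hG₃]; ring
    have h1 := ((hVd.fun_div hψBd (hψBpos t ht).ne').fun_sub hψBd).fun_sub (hG₂d.fun_div hGd (hGpos t ht).ne')
    refine (h1.congr_of_eventuallyEq (Filter.Eventually.of_forall hJ)).congr_deriv ?_
    have hB0 : ψB t ≠ 0 := (hψBpos t ht).ne'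
    have hG0 : G t ≠ 0 := (hGpos t ht).ne'
    rw [hJ']
    field_simp
  have hJid : ∀ t, 0 < t → J t = 0 →
      ψB t * (t * J' t) = (k : ℝ) * ((k : ℝ) + 1) * (N j₀ t / P j₀ t) ^ 2 *
        (((a : ℝ) + c - 3 * (G₂ t / G t)) - (2 * (k : ℝ) + 1) * (N j₀ t / P j₀ t)) := by
    intro t ht hJt
    have hψpos := hψBpos t ht
    have hG0 : G t ≠ 0 := (hGpos t ht).ne'
    obtain ⟨A, hA⟩ : ∃ A : ℝ, A = G₂ t / G t := ⟨_, rfl⟩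
    have hAa : (a : ℝ) < A := by rw [hA]; exact hAgt t ht
    -- rates and variances of the rows at `t`
    obtain ⟨e, he⟩ : ∃ e : Fin k → ℝ, ∀ i, e i = N i t / P i t := ⟨_, fun _ => rfl⟩
    obtain ⟨w, hw⟩ : ∃ w : Fin k → ℝ, ∀ i, w i = M i t / P i t - e i ^ 2 := ⟨_, fun _ => rfl⟩
    have heψ : ∀ i, ψ i t = e i := fun i => by rw [hψ, he]
    have hψe : ψB t = ∑ i, e i := by rw [hψB]; exact sum_congr rfl fun i _ => heψ i
    have hVw : V t = ∑ i, w i := by rw [hV]; exact sum_congr rfl fun i _ => by rw [hw, heψ]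
    have henn : ∀ i, 0 ≤ e i := fun i => by rw [← heψ]; exact hψnn i t ht
    have hwe : ∀ i, e i * ((a : ℝ) - e i) ≤ w i := by
      intro i
      have hP0 : 0 < P i t := hPpos i t ht
      have h1 : (a : ℝ) * e i ≤ M i t / P i t := by
        rw [he, ← mul_div_assoc, div_le_div_iff_of_pos_right hP0, hM, hN]
        have : (a : ℝ) * ((c : ℝ) * s i * t ^ c) ≤ (c : ℝ) ^ 2 * s i * t ^ c := by
          have h2 : 0 ≤ (c : ℝ) * s i * t ^ c := mul_nonneg (mul_nonneg hc'.le (h i).2.2) (pow_pos ht c).le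
          nlinarith
        nlinarith
      rw [hw]; nlinarith
    have hVeq : V t = ψB t * (ψB t + A) := by
      rw [hJ, ← hA] at hJt
      field_simp at hJt
      linarith
    -- the support identity `X(X−a)(X−c) = 0`: third moments from second ones
    have hLMN : ∀ i, L i t = ((a : ℝ) + c) * M i t - (a : ℝ) * c * N i t := fun i => by
      rw [hL, hM, hN]; ring
    have hV₃e : V₃ t = ((a : ℝ) + c) * (∑ i, w i) - 3 * (∑ i, w i * e i) + ((a : ℝ) + c) * (∑ i, e i ^ 2)
        - (a : ℝ) * c * (∑ i, e i) - ∑ i, e i ^ 3 := by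
      rw [hV₃, mul_sum, mul_sum, mul_sum, mul_sum, ← sum_sub_distrib, ← sum_add_distrib, ← sum_sub_distrib,
        ← sum_sub_distrib]
      refine sum_congr rfl fun i _ => ?_
      have hP0 : P i t ≠ 0 := (hPpos i t ht).ne'
      rw [hw, he, hLMN]
      field_simp
      ring
    have hVarA : (G₃ t * G t - G₂ t * G₂ t) / G t ^ 2 = (A - a) * ((c : ℝ) - A) := by
      rw [hA, div_eq_iff (pow_ne_zero 2 hG0)]
      field_simp
      rw [hG₃, hG₂, hG]
      ring
    have h1' : ∑ i, w i * (e i + ∑ j, e j) = ∑ i, w i * e i + (∑ j, e j) * ∑ i, w i := by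
      rw [Finset.mul_sum, ← Finset.sum_add_distrib]
      exact Finset.sum_congr rfl fun i _ => by ring
    have h2' : ∑ i, e i * (e i - a) * (e i - c)
        = ∑ i, e i ^ 3 - ((a : ℝ) + c) * ∑ i, e i ^ 2 + (a : ℝ) * c * ∑ i, e i := by
      rw [Finset.mul_sum, Finset.mul_sum, ← Finset.sum_sub_distrib, ← Finset.sum_add_distrib]
      exact Finset.sum_congr rfl fun i _ => by ring
    have htJ : t * J' t = (V₃ t * ψB t - V t * V t) / ψB t ^ 2 - V t - (G₃ t * G t - G₂ t * G₂ t) / G t ^ 2 := by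
      rw [hJ']; field_simp
    have hid : ψB t * (t * J' t) =
        -3 * (∑ i, w i * e i + (∑ j, e j) * ∑ i, w i)
          - (∑ i, e i ^ 3 - ((a : ℝ) + c) * ∑ i, e i ^ 2 + (a : ℝ) * c * ∑ i, e i)
          + (c + ∑ i, e i) * (∑ i, e i) * (a + ∑ i, e i) := by
      rw [htJ, hVarA, hV₃e, ← hVw, ← hψe, hVeq]
      field_simp
      ring
    -- identical rows: all rates/variances coincide
    have hee : ∀ i, e i = e j₀ := fun i => by rw [he, he, hN, hN, hP, hP]; simp only [hp, hq, hs]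
    have hww : ∀ i, w i = w j₀ := fun i => by rw [hw, hw, hee, hM, hM, hP, hP]; simp only [hp, hq, hs]
    have hk' : (Fintype.card (Fin k) : ℝ) = k := by simp
    have hSe : ∑ i, e i = (k : ℝ) * e j₀ := by
      rw [Finset.sum_congr rfl (fun i _ => hee i), Finset.sum_const, Finset.card_univ, nsmul_eq_mul, hk']
    have hSe2 : ∑ i, e i ^ 2 = (k : ℝ) * e j₀ ^ 2 := by
      rw [Finset.sum_congr rfl (fun i _ => by rw [hee i]), Finset.sum_const, Finset.card_univ, nsmul_eq_mul, hk']
    have hSe3 : ∑ i, e i ^ 3 = (k : ℝ) * e j₀ ^ 3 := by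
      rw [Finset.sum_congr rfl (fun i _ => by rw [hee i]), Finset.sum_const, Finset.card_univ, nsmul_eq_mul, hk']
    have hSw : ∑ i, w i = (k : ℝ) * w j₀ := by
      rw [Finset.sum_congr rfl (fun i _ => hww i), Finset.sum_const, Finset.card_univ, nsmul_eq_mul, hk']
    have hSwe : ∑ i, w i * e i = (k : ℝ) * (w j₀ * e j₀) := by
      rw [Finset.sum_congr rfl (fun i _ => by rw [hww i, hee i]), Finset.sum_const, Finset.card_univ, nsmul_eq_mul, hk']
    have hkpos : (0 : ℝ) < k := by exact_mod_cast hk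
    have hw₀ : w j₀ = e j₀ * ((k : ℝ) * e j₀ + A) := by
      have h1 : (k : ℝ) * w j₀ = (k : ℝ) * e j₀ * ((k : ℝ) * e j₀ + A) := by rw [← hSw, ← hVw, hVeq, hψe, hSe]
      have h2 : (k : ℝ) * (w j₀ - e j₀ * ((k : ℝ) * e j₀ + A)) = 0 := by linarith
      rcases mul_eq_zero.1 h2 with h3 | h3
      · exact absurd h3 hkpos.ne'
      · linarith
    rw [hid, hSwe, hSe, hSw, hSe2, hSe3, hw₀, ← he, hA]
    ring

  -- the threshold function `T` is strictly decreasing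
  obtain ⟨T, hT⟩ : ∃ T : ℝ → ℝ, ∀ t, T t = ((a : ℝ) + c - 3 * (G₂ t / G t)) - (2 * (k : ℝ) + 1) * (N j₀ t / P j₀ t) :=
    ⟨_, fun _ => rfl⟩
  have hTanti : ∀ t t', 0 < t → t < t' → T t' < T t := by
    intro t t' ht htt
    have h1 := rowRate_strictMono ha hac hp₀ hq₀ hs₀ ht htt
    have h2 := ratio_mono ha hac hκ hγ ht htt.le
    rw [hT, hT, hN, hN, hP, hP, hG₂, hG₂, hG, hG, hp, hq, hs]
    have hk0 : (0 : ℝ) < 2 * (k : ℝ) + 1 := by positivity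
    nlinarith [mul_lt_mul_of_pos_left h1 hk0]
  -- sign of `J′` at a zero of `J`
  have hepos : ∀ t, 0 < t → 0 < N j₀ t / P j₀ t := by
    intro t ht
    have hNi : 0 < N j₀ t := by
      rw [hN, hs]
      exact add_pos_of_nonneg_of_pos (mul_nonneg (mul_nonneg ha'.le (h j₀).2.1) (pow_pos ht a).le) (by positivity)
    exact div_pos hNi (hPpos j₀ t ht)
  have hkpos : (0 : ℝ) < k := by exact_mod_cast hk
  have hJ'pos : ∀ t, 0 < t → J t = 0 → 0 < T t → 0 < J' t := by
    intro t ht hJt hTt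
    have hid := hJid t ht hJt
    rw [← hT] at hid
    have hpos : 0 < (k : ℝ) * ((k : ℝ) + 1) * (N j₀ t / P j₀ t) ^ 2 * T t := by
      have := hepos t ht; positivity
    by_contra hle
    push Not at hle
    have : ψB t * (t * J' t) ≤ 0 := mul_nonpos_of_nonneg_of_nonpos (hψBpos t ht).le (mul_nonpos_of_nonneg_of_nonpos ht.le hle)
    linarith
  have hJ'neg : ∀ t, 0 < t → J t = 0 → T t < 0 → J' t < 0 := by
    intro t ht hJt hTt
    have hid := hJid t ht hJt
    rw [← hT] at hid
    have hneg : (k : ℝ) * ((k : ℝ) + 1) * (N j₀ t / P j₀ t) ^ 2 * T t < 0 := by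
      have := hepos t ht
      exact mul_neg_of_pos_of_neg (by positivity) hTt
    by_contra hle
    push Not at hle
    have : 0 ≤ ψB t * (t * J' t) := mul_nonneg (hψBpos t ht).le (mul_nonneg ht.le hle)
    linarith
  -- zeros of `J` between consecutive critical points (engine), in `J`-form
  have hRolle : ∀ u v, 0 < u → u < v →
      (derivative (row a c (-α) κ γ * ∏ i, row a c (p i) (q i) (s i))).eval u = 0 →
      (derivative (row a c (-α) κ γ * ∏ i, row a c (p i) (q i) (s i))).eval v = 0 → ∃ ξ, u < ξ ∧ ξ < v ∧ J ξ = 0 := by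
    intro u v hu huv hDu hDv
    obtain ⟨ξ, h1, h2, h3⟩ := exists_rateJ_zero_between_crit k a c ha hac α κ γ p q s hκ hγ h' hu huv hDu hDv
    exact ⟨ξ, h1, h2, by rw [hJfun]; exact h3⟩
  -- five critical points are impossible
  rw [posCrit]
  by_contra hcard
  rw [not_le] at hcard
  set S := (derivative (row a c (-α) κ γ * ∏ i, row a c (p i) (q i) (s i))).roots.toFinset.filter (fun t => 0 < t) with hS
  have h5 : 5 ≤ S.card := hcard
  set f := S.orderEmbOfFin rfl with hf
  have hmem : ∀ i : Fin S.card, f i ∈ S := fun i => Finset.orderEmbOfFin_mem S rfl i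
  have hinfo : ∀ i : Fin S.card, 0 < f i ∧ (derivative (row a c (-α) κ γ * ∏ i, row a c (p i) (q i) (s i))).eval (f i) = 0 := by
    intro i
    have hi := Finset.mem_filter.1 (hmem i)
    have hi2 := Multiset.mem_toFinset.1 hi.1
    rw [mem_roots', IsRoot.def] at hi2
    exact ⟨hi.2, hi2.2⟩
  have hlt : ∀ i j : Fin S.card, i < j → f i < f j := fun i j hij => f.strictMono hij
  set i0 : Fin S.card := ⟨0, by omega⟩
  set i1 : Fin S.card := ⟨1, by omega⟩
  set i2 : Fin S.card := ⟨2, by omega⟩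
  set i3 : Fin S.card := ⟨3, by omega⟩
  set i4 : Fin S.card := ⟨4, by omega⟩
  obtain ⟨ξ₁, h1a, h1b, hJ1⟩ := hRolle (f i0) (f i1) (hinfo i0).1 (hlt i0 i1 (by simp [i0, i1])) (hinfo i0).2 (hinfo i1).2
  obtain ⟨ξ₂, h2a, h2b, hJ2⟩ := hRolle (f i1) (f i2) (hinfo i1).1 (hlt i1 i2 (by simp [i1, i2])) (hinfo i1).2 (hinfo i2).2
  obtain ⟨ξ₃, h3a, h3b, hJ3⟩ := hRolle (f i2) (f i3) (hinfo i2).1 (hlt i2 i3 (by simp [i2, i3])) (hinfo i2).2 (hinfo i3).2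
  obtain ⟨ξ₄, h4a, h4b, hJ4⟩ := hRolle (f i3) (f i4) (hinfo i3).1 (hlt i3 i4 (by simp [i3, i4])) (hinfo i3).2 (hinfo i4).2
  have hξ1 : 0 < ξ₁ := (hinfo i0).1.trans h1a
  have hξ12 : ξ₁ < ξ₂ := h1b.trans h2a
  have hξ23 : ξ₂ < ξ₃ := h2b.trans h3a
  have hξ34 : ξ₃ < ξ₄ := h3b.trans h4a
  have hξ3 : 0 < ξ₃ := hξ1.trans (hξ12.trans hξ23)
  rcases lt_or_ge 0 (T ξ₂) with hT2 | hT2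
  · -- `ξ₁ < ξ₂` both in `{T > 0}`: two up-crossings
    refine zero_once_local_of_deriv_pos hJd hξ1 hξ12 hJ1 hJ2 (fun z hz1 hz2 hJz => ?_)
    have hz : 0 < z := hξ1.trans_le hz1
    have hTz : 0 < T z := by
      rcases hz2.eq_or_lt with h | h
      · rw [h]; exact hT2
      · exact hT2.trans (hTanti z ξ₂ hz h)
    exact hJ'pos z hz hJz hTz
  · -- `ξ₃ < ξ₄` both in `{T < 0}`: two down-crossings
    have hT3 : T ξ₃ < 0 := (hTanti ξ₂ ξ₃ (hξ1.trans hξ12) hξ23).trans_le hT2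
    refine zero_once_local_of_deriv_neg hJd hξ3 hξ34 hJ3 hJ4 (fun z hz1 hz2 hJz => ?_)
    have hz : 0 < z := hξ3.trans_le hz1
    have hTz : T z < 0 := by
      rcases hz1.eq_or_lt with h | h
      · rw [← h]; exact hT3
      · exact (hTanti ξ₃ z hξ3 h).trans hT3
    exact hJ'neg z hz hJz hTz

end ZeroChange

end Summit.ValiantsHypothesis.ValiantsHypothesis.Theorems.LacunarySymmetroidMatrixDescartes
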